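import Mathlib.AlgebraicGeometry.Pullbacks
import Mathlib.CategoryTheory.Monoidal.Cartesian.Over
import HarnessLib

/-!
# Base change of schemes over a base: the dictionary between `Q ×_S T ⟶ P` and `Q_T ⟶ P_T`

Topic: `Literature/AlgebraicGeometry/Limits` (bookkeeping for the spreading-out of group laws
through `Spec A_S = lim Spec A[1/s]`, `Limits/LocalizationGroupSpread`). For a base scheme `S`,
an `S`-scheme `T` (an object of `Over S`, with its cartesian monoidal structure
`Q ⊗ T = Q ×_S T`) and `S`-schemes `Q`, `P`:

* `sliceHom T g` / `unsliceHom T ψ` — the bijection between `S`-morphisms `g : Q ⊗ T ⟶ P` and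
  `T`-morphisms `ψ : Q_T ⟶ P_T` of the base changes `Q_T = (Over.pullback T.hom).obj Q`,
  `(q, t) ↦ (g (q, t), t)` resp. `ψ ↦ ψ ≫ pr_P` (Görtz–Wedhorn I, §(4.7), the bijection (4.7.1)
  `Hom_{S'}(T, X_{(S')}) ≅ Hom_S(T, X)`);
* `pullbackFacObjIso φ a' a ha Y : (Y ×_S S') ×_{S'} T ≅ Y ×_S T` for a factorisation
  `a = a' ≫ φ : T → S' → S`, with *explicit* projections (Mathlib's `pullbackLeftPullbackSndIso`;
  the abstract `Over.pullbackComp` has no usable component formulas), assembled into the natural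
  isomorphism `pullbackFacIso : Over.pullback φ ⋙ Over.pullback a' ≅ Over.pullback a`;
* `pullback_map_sliceHom` — **compatibility of the dictionary with a change of `T`**: for
  `ℓ : T' ⟶ T` over `S`, the base change `(Over.pullback ℓ.left).map (sliceHom T g)` is, under the
  identifications `pullbackFacObjIso`, the morphism `sliceHom T' ((Q ◁ ℓ) ≫ g)` attached to the
  restriction of `g` to `Q ⊗ T'`.

Everything is elementary (universal property of the fibre product); no named facts.

## References

* U. Görtz, T. Wedhorn, *Algebraic Geometry I: Schemes*, 2nd ed. (2020), §(4.7) "Base change in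
  categories with fiber products": Prop. 4.16 and the transitivity of base change, and the
  bijection (4.7.1) (PDF pp. 127, 135). [GortzWedhorn2020]
-/

noncomputable section

universe u

open CategoryTheory CategoryTheory.Limits AlgebraicGeometry MonoidalCategory
  CartesianMonoidalCategory

namespace Literature.AlgebraicGeometry.Limits

set_option backward.isDefEq.respectTransparency false

/-! ## Iterated base change along a factorisation, with explicit projections -/

section FacIso

variable {S S' T : Scheme.{u}} (φ : S' ⟶ S) (a' : T ⟶ S') (a : T ⟶ S) (ha : a' ≫ φ = a)

/-- `(Y ×_S S') ×_{S'} T ≅ Y ×_S T` for `a = a' ≫ φ : T → S' → S` (transitivity of base change: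
Mathlib's `pullbackLeftPullbackSndIso` followed by `pullback.congrHom` along `a' ≫ φ = a`), as an
isomorphism of `T`-schemes. [cite: GortzWedhorn2020, §(4.7), Prop. 4.16 (transitivity of base change)] -/
def pullbackFacObjIso (Y : Over S) :
    (Over.pullback a').obj ((Over.pullback φ).obj Y) ≅ (Over.pullback a).obj Y :=
  Over.isoMk (pullbackLeftPullbackSndIso Y.hom φ a' ≪≫ pullback.congrHom rfl ha) (by
    simp only [Over.pullback_obj_hom, Iso.trans_hom, Category.assoc, pullback.congrHom_hom,
      pullback.lift_snd, Category.comp_id]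
    exact pullbackLeftPullbackSndIso_hom_snd Y.hom φ a')

/-- First projection of `pullbackFacObjIso`: `((y, s'), t) ↦ y`. [folklore] -/
@[reassoc (attr := simp)]
theorem pullbackFacObjIso_hom_left_fst (Y : Over S) :
    (pullbackFacObjIso φ a' a ha Y).hom.left ≫ pullback.fst Y.hom a =
      pullback.fst ((Over.pullback φ).obj Y).hom a' ≫ pullback.fst Y.hom φ := by
  simp [pullbackFacObjIso]
  rfl

/-- Second projection of `pullbackFacObjIso`: `((y, s'), t) ↦ t`. [folklore] -/
@[reassoc (attr := simp)]
theorem pullbackFacObjIso_hom_left_snd (Y : Over S) :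
    (pullbackFacObjIso φ a' a ha Y).hom.left ≫ pullback.snd Y.hom a =
      pullback.snd ((Over.pullback φ).obj Y).hom a' := by
  simp [pullbackFacObjIso]
  rfl

/-- Naturality of `pullbackFacObjIso` in `Y`. [folklore] -/
theorem pullbackFacObjIso_naturality {Y Z : Over S} (f : Y ⟶ Z) :
    (Over.pullback a').map ((Over.pullback φ).map f) ≫ (pullbackFacObjIso φ a' a ha Z).hom =
      (pullbackFacObjIso φ a' a ha Y).hom ≫ (Over.pullback a).map f := by
  ext : 1
  apply pullback.hom_ext
  · simp only [Over.comp_left, Category.assoc, pullbackFacObjIso_hom_left_fst,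
      Over.pullback_map_left, pullback.lift_fst, pullback.lift_fst_assoc,
      pullbackFacObjIso_hom_left_fst_assoc]
  · simp only [Over.comp_left, Category.assoc, pullbackFacObjIso_hom_left_snd,
      Over.pullback_map_left, pullback.lift_snd]

/-- **Transitivity of base change as a natural isomorphism with explicit projections**:
`Over.pullback φ ⋙ Over.pullback a' ≅ Over.pullback a` for `a = a' ≫ φ`. Being a natural
transformation between cartesian-monoidal functors it is automatically monoidal
(Mathlib `NatTrans.IsMonoidal.of_cartesianMonoidalCategory`). [cite: GortzWedhorn2020, §(4.7), Prop. 4.16 (transitivity of base change)] -/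
def pullbackFacIso : Over.pullback φ ⋙ Over.pullback a' ≅ Over.pullback a :=
  NatIso.ofComponents (pullbackFacObjIso φ a' a ha) (pullbackFacObjIso_naturality φ a' a ha)

/-- The components of `pullbackFacIso` (by `rfl`). [folklore] -/
@[simp]
theorem pullbackFacIso_hom_app (Y : Over S) :
    (pullbackFacIso φ a' a ha).hom.app Y = (pullbackFacObjIso φ a' a ha Y).hom := rfl

/-- The components of `pullbackFacIso.inv` (by `rfl`). [folklore] -/
@[simp]
theorem pullbackFacIso_inv_app (Y : Over S) :
    (pullbackFacIso φ a' a ha).inv.app Y = (pullbackFacObjIso φ a' a ha Y).inv := rfl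

end FacIso

/-! ## `S`-morphisms `Q ×_S T ⟶ P` versus `T`-morphisms `Q_T ⟶ P_T` -/

section Dict

variable {S : Scheme.{u}} (T : Over S) {Q P : Over S}

/-- From an `S`-morphism `g : Q ⊗ T = Q ×_S T ⟶ P` to the `T`-morphism `Q_T ⟶ P_T` of base
changes, `(q, t) ↦ (g (q, t), t)`; here `Q_T = (Over.pullback T.hom).obj Q` has the same underlying
scheme `Q ×_S T` as `Q ⊗ T`. [cite: GortzWedhorn2020, §(4.7), (4.7.1)] -/
def sliceHom (g : Q ⊗ T ⟶ P) : (Over.pullback T.hom).obj Q ⟶ (Over.pullback T.hom).obj P :=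
  Over.homMk (pullback.lift g.left (pullback.snd Q.hom T.hom) (by
      have h := Over.w g
      simp only [Over.tensorObj_hom] at h
      rw [h, pullback.condition])) (by simp)

/-- `sliceHom g` followed by the projection to `P` is `g`. [folklore] -/
@[reassoc (attr := simp)]
theorem sliceHom_left_fst (g : Q ⊗ T ⟶ P) :
    (sliceHom T g).left ≫ pullback.fst P.hom T.hom = g.left := by
  simp [sliceHom]

/-- `sliceHom g` is a `T`-morphism. [folklore] -/
@[reassoc (attr := simp)]
theorem sliceHom_left_snd (g : Q ⊗ T ⟶ P) :
    (sliceHom T g).left ≫ pullback.snd P.hom T.hom = pullback.snd Q.hom T.hom := by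
  simp [sliceHom]

/-- From a `T`-morphism `ψ : Q_T ⟶ P_T` to the `S`-morphism `Q ×_S T ⟶ P`, `ψ` followed by the
projection to `P`. [cite: GortzWedhorn2020, §(4.7), (4.7.1)] -/
def unsliceHom (ψ : (Over.pullback T.hom).obj Q ⟶ (Over.pullback T.hom).obj P) : Q ⊗ T ⟶ P :=
  Over.homMk (ψ.left ≫ pullback.fst P.hom T.hom) (by
    have h := Over.w ψ
    simp only [Over.pullback_obj_hom] at h
    simp only [Over.tensorObj_hom, Category.assoc, pullback.condition]
    rw [reassoc_of% h])

/-- The underlying morphism of `unsliceHom ψ` (by `rfl`). [folklore] -/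
@[simp]
theorem unsliceHom_left (ψ : (Over.pullback T.hom).obj Q ⟶ (Over.pullback T.hom).obj P) :
    (unsliceHom T ψ).left = ψ.left ≫ pullback.fst P.hom T.hom := rfl

/-- `unsliceHom` is left inverse to `sliceHom`. [folklore] -/
@[simp]
theorem unsliceHom_sliceHom (g : Q ⊗ T ⟶ P) : unsliceHom T (sliceHom T g) = g := by
  ext : 1
  simp

/-- `sliceHom` is left inverse to `unsliceHom`. [folklore] -/
@[simp]
theorem sliceHom_unsliceHom (ψ : (Over.pullback T.hom).obj Q ⟶ (Over.pullback T.hom).obj P) :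
    sliceHom T (unsliceHom T ψ) = ψ := by
  ext : 1
  apply pullback.hom_ext
  · simp
  · have h := Over.w ψ
    simp only [Over.pullback_obj_hom] at h
    simp [h]

/-- The dictionary as an equivalence `(Q ⊗ T ⟶ P) ≃ (Q_T ⟶ P_T)` (the bijection (4.7.1) of
Görtz–Wedhorn I, "functorial in `T` and in `X`"). [cite: GortzWedhorn2020, §(4.7), (4.7.1)] -/
def sliceEquiv : (Q ⊗ T ⟶ P) ≃ ((Over.pullback T.hom).obj Q ⟶ (Over.pullback T.hom).obj P) where
  toFun := sliceHom T
  invFun := unsliceHom T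
  left_inv := unsliceHom_sliceHom T
  right_inv := sliceHom_unsliceHom T

end Dict

/-! ## Compatibility with a change of `T` -/

section Change

variable {S : Scheme.{u}} {T' T : Over S} (ℓ : T' ⟶ T) (Q : Over S) {P : Over S}

/-- Under `(Q ×_S T) ×_T T' ≅ Q ×_S T'`, the base change `Q_T ×_T T' → Q_T = Q ×_S T` of `ℓ` is the
morphism `Q ◁ ℓ : Q ⊗ T' ⟶ Q ⊗ T`. [folklore] -/
@[reassoc]
theorem pullbackFacObjIso_hom_left_whiskerLeft :
    (pullbackFacObjIso T.hom ℓ.left T'.hom (Over.w ℓ) Q).hom.left ≫ (Q ◁ ℓ).left =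
      pullback.fst ((Over.pullback T.hom).obj Q).hom ℓ.left := by
  apply pullback.hom_ext
  · rw [Category.assoc, Over.whiskerLeft_left_fst]
    exact pullbackFacObjIso_hom_left_fst T.hom ℓ.left T'.hom (Over.w ℓ) Q
  · rw [Category.assoc, Over.whiskerLeft_left_snd, pullbackFacObjIso_hom_left_snd_assoc]
    exact pullback.condition.symm

variable {Q}

/-- **The dictionary commutes with base change in `T`.** For `ℓ : T' ⟶ T` over `S` and
`g : Q ⊗ T ⟶ P`, the base change of `sliceHom T g : Q_T ⟶ P_T` along `ℓ` is identified, via the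
transitivity isomorphisms `(–)_T ×_T T' ≅ (–)_{T'}`, with `sliceHom T' ((Q ◁ ℓ) ≫ g)`, the
`T'`-morphism attached to the restriction of `g` to `Q ⊗ T'` (functoriality of (4.7.1) in `T`). [cite: GortzWedhorn2020, §(4.7), (4.7.1) and Prop. 4.16] -/
theorem pullback_map_sliceHom (g : Q ⊗ T ⟶ P) :
    (Over.pullback ℓ.left).map (sliceHom T g) ≫
        (pullbackFacObjIso T.hom ℓ.left T'.hom (Over.w ℓ) P).hom =
      (pullbackFacObjIso T.hom ℓ.left T'.hom (Over.w ℓ) Q).hom ≫ sliceHom T' ((Q ◁ ℓ) ≫ g) := by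
  ext : 1
  apply pullback.hom_ext
  · rw [Over.comp_left, Over.comp_left, Category.assoc, Category.assoc,
      pullbackFacObjIso_hom_left_fst, sliceHom_left_fst, Over.comp_left,
      pullbackFacObjIso_hom_left_whiskerLeft_assoc]
    simp only [Over.pullback_map_left, pullback.lift_fst_assoc, Category.assoc, sliceHom_left_fst]
  · rw [Over.comp_left, Over.comp_left, Category.assoc, Category.assoc,
      pullbackFacObjIso_hom_left_snd, sliceHom_left_snd]
    simp only [Over.pullback_map_left, pullback.lift_snd]
    exact (pullbackFacObjIso_hom_left_snd T.hom ℓ.left T'.hom (Over.w ℓ) Q).symm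

/-- The same for `unsliceHom`: restricting `unsliceHom T ψ` to `Q ⊗ T'` gives `unsliceHom T'` of
the base change of `ψ` (conjugated by the transitivity isomorphisms). [cite: GortzWedhorn2020, §(4.7), (4.7.1) and Prop. 4.16] -/
theorem whiskerLeft_comp_unsliceHom
    (ψ : (Over.pullback T.hom).obj Q ⟶ (Over.pullback T.hom).obj P) :
    (Q ◁ ℓ) ≫ unsliceHom T ψ =
      unsliceHom T' ((pullbackFacObjIso T.hom ℓ.left T'.hom (Over.w ℓ) Q).inv ≫
        (Over.pullback ℓ.left).map ψ ≫ (pullbackFacObjIso T.hom ℓ.left T'.hom (Over.w ℓ) P).hom) := by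
  apply (sliceEquiv T').injective
  change sliceHom T' _ = sliceHom T' _
  rw [sliceHom_unsliceHom, Iso.eq_inv_comp, ← pullback_map_sliceHom, sliceHom_unsliceHom]

end Change

end Literature.AlgebraicGeometry.Limits

end
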